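import Literature.MeasureTheory.RandomSets.AvoidanceFunctional
import Literature.Probability.Percolation.OneArmScalingLimitProofs
import Mathlib.Analysis.Real.Cardinality
import Mathlib.Topology.Metrizable.Basic
import HarnessLib

/-!
# Avoidance events of LSW's random compact sets `Q_δ`: discs, continuity radii, connection events

Topic `Literature/Probability/Percolation`, companion to `OneArmScalingLimit.lean` and
`OneArmScalingLimitProofs.lean` (proofs only: no definitions, no named facts); the tools of this
file are assembled in `OneArmScalingLimitConnection.lean` into the equivalence of the named fact
`LawlerSchrammWerner2002_scalingLimit` (Lawler–Schramm–Werner, Electron. J. Probab. 7 (2002), §2,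
p. 3: weak convergence of the laws `lswLaw R` of `Q_{1/R} = lswCompact R` on the Hausdorff space)
with the convergence of percolation connection probabilities. The law of a random compact set
being determined by its avoidance functional `U ↦ P[K ∩ U = ∅]` on finite unions of sets of a
countable basis (`Literature.MeasureTheory.RandomSets`; Molchanov 2005, Chap. 1, §1.6 and App. C,
Thm. C.5), one needs (i) a countable basis of discs whose avoidance events are continuity sets of
given limit laws, and (ii) the identification of the avoidance events of `Q_{1/R}` with
percolation events:

* `disjoint_ball_iff_le_infDist`, `frontier_setOf_disjoint_ball_subset`,
  `frontier_setOf_disjoint_biUnion_ball_subset` — the avoidance event of a disc is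
  `{K | r ≤ dist(z, K)}` and its frontier lies in the level set `{dist(z, K) = r}`; the same for
  finite unions of discs (`frontier_biInter_finset_subset_of_isClosed`).
* `countable_setOf_measure_infDist_eq_pos`, `measure_frontier_setOf_disjoint_biUnion_ball_eq_zero`
  — for a finite Borel measure on the Hausdorff space and a centre `z`, all but countably many
  radii `r` have `μ {dist(z, K) = r} = 0` (*continuity radii*), and then the avoidance events of
  finite unions of such discs are `μ`-continuity sets (Billingsley 1999, §2, p. 16).
* `exists_isTopologicalBasis_ball` — a countable basis of `ℂ` by open discs with centres in a
  given dense set or on the unit circle and radii off given countable sets, each disc lying in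
  `𝕌` (`ρ ≤ 1 - ‖z‖`), centred on `∂𝕌`, or missing `Ū` (`ρ ≤ ‖z‖ - 1`).
* `lswCompact_mem_setOf_disjoint_iff`, `lswLaw_setOf_disjoint_eq` — for `R > 0` and an open
  `U ⊆ 𝕌`, `{Q_{1/R} ∩ U = ∅}` is the complement of the connection event "some site `x` with
  `x/R ∈ U` is joined by an open path of `𝕋` to some `y` with `‖y‖ > R`", so that
  `P[Q_{1/R} ∩ U = ∅] = 1 - P_{1/2}[R·U ↔ {‖·‖ > R}]` (LSW 2002, §2, p. 3: `Q_δ = ∂𝕌 ∪` the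
  clusters of `Ū` meeting `∂𝕌`); discs meeting `∂𝕌 ⊆ Q_δ` are never avoided
  (`lswCompact_not_mem_setOf_disjoint_of_mem_sphere`) and sets missing `Ū ⊇ Q_δ` are irrelevant
  (`lswCompact_mem_setOf_disjoint_union_iff`).

## References

* G. F. Lawler, O. Schramm, W. Werner, *One-arm exponent for critical 2D percolation*, Electron.
  J. Probab. 7 (2002), no. 2, §2 (p. 3) [LawlerSchrammWernerEJP2002].
* I. Molchanov, *Theory of Random Sets*, Springer (2005), Chap. 1, §1.6; App. C, Thm. C.5
  [Molchanov2005].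
* P. Billingsley, *Convergence of probability measures*, 2nd ed. (1999), §2, Thm. 2.1
  [Billingsley1999].
-/

noncomputable section

open MeasureTheory Filter Topology Metric TopologicalSpace Set
open Literature.MeasureTheory.RandomSets Literature.Probability.LatticeModels
open scoped ENNReal NNReal

namespace Literature.Probability.Percolation

/-! ### Avoidance events of discs in the Hausdorff space -/

/-- A nonempty compact set misses the open disc `B(z, r)` iff `r ≤ dist(z, K)`. [folklore] -/
theorem disjoint_ball_iff_le_infDist {K : NonemptyCompacts ℂ} {z : ℂ} {r : ℝ} :
    Disjoint (K : Set ℂ) (ball z r) ↔ r ≤ infDist z (K : Set ℂ) := by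
  constructor
  · intro h
    by_contra hlt
    rw [not_le, infDist_lt_iff K.nonempty] at hlt
    obtain ⟨x, hxK, hx⟩ := hlt
    exact disjoint_left.1 h hxK (mem_ball'.2 hx)
  · intro h
    exact disjoint_left.2 fun x hxK hx =>
      (lt_irrefl r) (lt_of_le_of_lt (h.trans (infDist_le_dist_of_mem hxK)) (mem_ball'.1 hx))

/-- The avoidance event of a disc as a superlevel set of `K ↦ dist(z, K)`. [folklore] -/
theorem setOf_disjoint_ball_eq (z : ℂ) (r : ℝ) :
    {K : NonemptyCompacts ℂ | Disjoint (K : Set ℂ) (ball z r)} =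
      {K : NonemptyCompacts ℂ | r ≤ infDist z (K : Set ℂ)} := by
  ext K
  exact disjoint_ball_iff_le_infDist

/-- `K ↦ dist(z, K)` is continuous (indeed `1`-Lipschitz) for the Hausdorff metric. [folklore] -/
theorem continuous_infDist_nonemptyCompacts (z : ℂ) :
    Continuous fun K : NonemptyCompacts ℂ => infDist z (K : Set ℂ) :=
  (lipschitz_infDist_set z).continuous

/-- `K ↦ dist(z, K)` is Borel measurable on the Hausdorff space. [folklore] -/
theorem measurable_infDist_nonemptyCompacts (z : ℂ) :
    Measurable fun K : NonemptyCompacts ℂ => infDist z (K : Set ℂ) :=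
  (continuous_infDist_nonemptyCompacts z).measurable

/-- **The frontier of the avoidance event of a disc lies in a level set of the distance**:
`∂{K | K ∩ B(z, r) = ∅} ⊆ {K | dist(z, K) = r}`. [folklore] -/
theorem frontier_setOf_disjoint_ball_subset (z : ℂ) (r : ℝ) :
    frontier {K : NonemptyCompacts ℂ | Disjoint (K : Set ℂ) (ball z r)} ⊆
      {K : NonemptyCompacts ℂ | infDist z (K : Set ℂ) = r} := by
  rw [setOf_disjoint_ball_eq]
  refine (frontier_le_subset_eq continuous_const (continuous_infDist_nonemptyCompacts z)).trans ?_
  intro K hK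
  exact (Eq.symm hK)

/-- Frontier of a finite intersection of closed sets: it lies in the union of the frontiers.
[folklore] -/
theorem frontier_biInter_finset_subset_of_isClosed {X ι : Type*} [TopologicalSpace X]
    (s : Finset ι) (A : ι → Set X) (hA : ∀ i ∈ s, IsClosed (A i)) :
    frontier (⋂ i ∈ s, A i) ⊆ ⋃ i ∈ s, frontier (A i) := by
  intro x hx
  have hcl : IsClosed (⋂ i ∈ s, A i) := isClosed_biInter hA
  rw [hcl.frontier_eq, s.interior_iInter] at hx
  obtain ⟨hxA, hxint⟩ := hx
  rw [mem_iInter₂] at hxA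
  simp only [mem_iInter, not_forall] at hxint
  obtain ⟨i, hi, hxi⟩ := hxint
  refine mem_biUnion hi ?_
  rw [(hA i hi).frontier_eq]
  exact ⟨hxA i hi, hxi⟩

/-- **The frontier of the avoidance event of a finite union of discs** lies in the union of the
level sets `{dist(zᵢ, K) = rᵢ}`. [folklore] -/
theorem frontier_setOf_disjoint_biUnion_ball_subset (F : Finset (ℂ × ℝ)) :
    frontier {K : NonemptyCompacts ℂ | Disjoint (K : Set ℂ) (⋃ p ∈ F, ball p.1 p.2)} ⊆
      ⋃ p ∈ F, {K : NonemptyCompacts ℂ | infDist p.1 (K : Set ℂ) = p.2} := by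
  rw [setOf_disjoint_biUnion_finset]
  refine (frontier_biInter_finset_subset_of_isClosed F _ fun p _ =>
    isClosed_setOf_disjoint isOpen_ball).trans ?_
  exact iUnion₂_mono fun p _ => frontier_setOf_disjoint_ball_subset p.1 p.2

/-- **Continuity radii**: for a finite (indeed s-finite) Borel measure `μ` on the Hausdorff space
and a centre `z`, only countably many radii `r` have `μ {K | dist(z, K) = r} > 0` (the level sets
of `K ↦ dist(z, K)` are disjoint). [folklore] -/
theorem countable_setOf_measure_infDist_eq_pos (μ : Measure (NonemptyCompacts ℂ)) [SFinite μ]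
    (z : ℂ) : {r : ℝ | 0 < μ {K : NonemptyCompacts ℂ | infDist z (K : Set ℂ) = r}}.Countable :=
  Measure.countable_meas_level_set_pos (measurable_infDist_nonemptyCompacts z)

/-- Off the countable exceptional set, the avoidance event of a finite union of discs is a
continuity set: its frontier is `μ`-null. [folklore] -/
theorem measure_frontier_setOf_disjoint_biUnion_ball_eq_zero (μ : Measure (NonemptyCompacts ℂ))
    (F : Finset (ℂ × ℝ))
    (hF : ∀ p ∈ F, μ {K : NonemptyCompacts ℂ | infDist p.1 (K : Set ℂ) = p.2} = 0) :
    μ (frontier {K : NonemptyCompacts ℂ | Disjoint (K : Set ℂ) (⋃ p ∈ F, ball p.1 p.2)}) = 0 :=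
  measure_mono_null (frontier_setOf_disjoint_biUnion_ball_subset F)
    ((measure_biUnion_null_iff F.countable_toSet).2 hF)

/-- A finite union of open discs is open. [folklore] -/
theorem isOpen_biUnion_ball (F : Finset (ℂ × ℝ)) : IsOpen (⋃ p ∈ F, ball p.1 p.2) :=
  isOpen_iUnion fun _ => isOpen_iUnion fun _ => isOpen_ball

/-- The avoidance event of a finite union of open discs is Borel measurable. [folklore] -/
theorem measurableSet_setOf_disjoint_biUnion_ball (F : Finset (ℂ × ℝ)) :
    MeasurableSet {K : NonemptyCompacts ℂ | Disjoint (K : Set ℂ) (⋃ p ∈ F, ball p.1 p.2)} :=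
  measurableSet_setOf_disjoint (isOpen_biUnion_ball F)

/-! ### A countable basis of discs adapted to the unit circle -/

/-- A disc `B(z, ρ)` with `ρ ≤ 1 - ‖z‖` lies in the open unit disc. [folklore] -/
theorem ball_subset_ball_zero_one {z : ℂ} {ρ : ℝ} (h : ρ ≤ 1 - ‖z‖) :
    ball z ρ ⊆ ball (0 : ℂ) 1 := by
  intro x hx
  rw [mem_ball, dist_zero_right]
  rw [mem_ball] at hx
  calc ‖x‖ = ‖(x - z) + z‖ := by rw [sub_add_cancel]
    _ ≤ ‖x - z‖ + ‖z‖ := norm_add_le _ _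
    _ < ρ + ‖z‖ := by rw [← dist_eq_norm]; gcongr
    _ ≤ 1 := by linarith

/-- A disc `B(z, ρ)` with `ρ ≤ ‖z‖ - 1` misses the closed unit disc. [folklore] -/
theorem disjoint_ball_closedBall_zero_one {z : ℂ} {ρ : ℝ} (h : ρ ≤ ‖z‖ - 1) :
    Disjoint (ball z ρ) (closedBall (0 : ℂ) 1) := by
  refine disjoint_left.2 fun x hx hx' => ?_
  rw [mem_ball, dist_eq_norm] at hx
  rw [mem_closedBall, dist_zero_right] at hx'
  have : ‖z‖ ≤ ‖x‖ + ‖x - z‖ := by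
    calc ‖z‖ = ‖x - (x - z)‖ := by rw [sub_sub_cancel]
      _ ≤ ‖x‖ + ‖x - z‖ := norm_sub_le _ _
  linarith

/-- **A countable basis of discs adapted to the circle.** Given a dense set `D ⊆ ℂ` and, for each
centre, a countable set of forbidden radii, there is a countable topological basis of `ℂ`
consisting of open discs `B(z, ρ)`, `ρ > 0` not forbidden for `z`, each of which either lies in the
open unit disc `𝕌` with centre in `D` (`ρ ≤ 1 - ‖z‖`), or is centred on the unit circle, or misses
the closed unit disc (`ρ ≤ ‖z‖ - 1`). (Centres: a countable dense subset of `D` together with a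
countable dense subset of the circle; radii: in each rational interval a non-forbidden radius
exists, intervals being uncountable.) [folklore] -/
theorem exists_isTopologicalBasis_ball {D : Set ℂ} (hD : Dense D) (bad : ℂ → Set ℝ)
    (hbad : ∀ z, (bad z).Countable) :
    ∃ b : Set (Set ℂ), b.Countable ∧ IsTopologicalBasis b ∧
      ∀ V ∈ b, ∃ z : ℂ, ∃ ρ : ℝ, 0 < ρ ∧ ρ ∉ bad z ∧ V = ball z ρ ∧
        ((z ∈ D ∧ ρ ≤ 1 - ‖z‖) ∨ ‖z‖ = 1 ∨ ρ ≤ ‖z‖ - 1) := by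
  classical
  -- centres: a countable dense subset `D'` of `D` and a countable dense subset `S` of the circle
  obtain ⟨D', hD'D, hD'c, hD'd⟩ := hD.exists_countable_dense_subset
  obtain ⟨S, hSsph, hSc, hSd⟩ :=
    (IsSeparable.of_separableSpace (sphere (0 : ℂ) 1)).exists_countable_dense_subset
  -- radii: a non-forbidden radius in each nonempty rational interval
  have hrad : ∀ (z : ℂ) (p q : ℚ), (p : ℝ) < q → ∃ ρ : ℝ, ρ ∈ Ioo (p : ℝ) q ∧ ρ ∉ bad z := by
    intro z p q hpq
    by_contra h
    push Not at h
    have hsub : Ioo (p : ℝ) q ⊆ bad z := fun ρ hρ => h ρ hρ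
    have hc : (Ioo (p : ℝ) q).Countable := (hbad z).mono hsub
    rw [Cardinal.Real.Ioo_countable_iff] at hc
    exact absurd hpq (not_lt.2 hc)
  choose! ρ hρ using hrad
  -- admissibility of a centre/upper-radius pair
  let adm : ℂ → ℚ → Prop := fun z q => (z ∈ D' ∧ (q : ℝ) ≤ 1 - ‖z‖) ∨ ‖z‖ = 1 ∨ (q : ℝ) ≤ ‖z‖ - 1
  let I : Set (ℂ × ℚ × ℚ) :=
    {t | t.1 ∈ D' ∪ S ∧ 0 < t.2.1 ∧ (t.2.1 : ℝ) < t.2.2 ∧ adm t.1 t.2.2}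
  let f : ℂ × ℚ × ℚ → Set ℂ := fun t => ball t.1 (ρ t.1 t.2.1 t.2.2)
  refine ⟨f '' I, ?_, ?_, ?_⟩
  · -- countable
    refine (Countable.mono (fun t ht => ?_) ((hD'c.union hSc).prod (Set.countable_univ
      (α := ℚ × ℚ)))).image f
    exact ⟨ht.1, mem_univ _⟩
  · -- a topological basis
    refine isTopologicalBasis_of_isOpen_of_nhds ?_ ?_
    · rintro _ ⟨t, _, rfl⟩
      exact isOpen_ball
    · intro a u hau hu
      obtain ⟨ε₀, hε₀, hε₀u⟩ := Metric.isOpen_iff.1 hu a hau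
      -- the generic step: from a centre `z` close to `a` with `adm` guaranteed for small `q`
      have key : ∀ (ε : ℝ), 0 < ε → ε ≤ ε₀ → ∀ z ∈ D' ∪ S, dist a z < ε / 3 →
          (∀ q : ℚ, (q : ℝ) < ε → adm z q) → ∃ v ∈ f '' I, a ∈ v ∧ v ⊆ u := by
        intro ε hε hεε₀ z hz haz hadm
        obtain ⟨p, hp₁, hp₂⟩ := exists_rat_btwn haz
        have hq' : (p : ℝ) < ε - dist a z := by linarith
        obtain ⟨q, hq₁, hq₂⟩ := exists_rat_btwn hq'
        have hpq : (p : ℝ) < q := hq₁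
        have hp0 : (0 : ℚ) < p := by
          have : (0 : ℝ) < p := lt_of_le_of_lt dist_nonneg hp₁
          exact_mod_cast this
        have hqε : (q : ℝ) < ε := by linarith [dist_nonneg (x := a) (y := z)]
        obtain ⟨hρI, -⟩ := hρ z p q hpq
        refine ⟨f (z, p, q), ⟨(z, p, q), ⟨hz, hp0, hpq, hadm q hqε⟩, rfl⟩, ?_, ?_⟩
        · show a ∈ ball z (ρ z p q)
          rw [mem_ball]
          exact lt_trans hp₁ hρI.1
        · intro x hx
          apply hε₀u
          have hx' : dist x z < ρ z p q := mem_ball.1 hx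
          rw [mem_ball]
          calc dist x a ≤ dist x z + dist z a := dist_triangle _ _ _
            _ < ρ z p q + dist a z := by rw [dist_comm z a]; gcongr
            _ < q + dist a z := by gcongr; exact hρI.2
            _ < ε := by linarith
            _ ≤ ε₀ := hεε₀
      by_cases ha : ‖a‖ = 1
      · -- centre on the circle
        have ha' : a ∈ closure S := hSd (by simpa using ha)
        obtain ⟨z, hzS, haz⟩ := Metric.mem_closure_iff.1 ha' (ε₀ / 3) (by positivity)
        exact key ε₀ hε₀ le_rfl z (Or.inr hzS) haz fun q _ => Or.inr (Or.inl (by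
          have := hSsph hzS
          simpa using this))
      · -- centre off the circle: small discs are inside `𝕌` or outside `Ū`
        have hδ : 0 < |1 - ‖a‖| := abs_pos.2 (sub_ne_zero.2 (Ne.symm ha))
        set ε := min ε₀ (|1 - ‖a‖| / 2) with hε_def
        have hε : 0 < ε := lt_min hε₀ (by positivity)
        have hεε₀ : ε ≤ ε₀ := min_le_left _ _
        have hεδ : ε ≤ |1 - ‖a‖| / 2 := min_le_right _ _
        obtain ⟨z, hzD', haz⟩ := Metric.mem_closure_iff.1 (hD'd.closure_eq.symm ▸ mem_univ a)
          (ε / 3) (by positivity)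
        refine key ε hε hεε₀ z (Or.inl hzD') haz fun q hq => ?_
        have hnorm : |‖a‖ - ‖z‖| ≤ dist a z := by
          rw [dist_eq_norm]
          exact abs_norm_sub_norm_le a z
        rcases lt_or_gt_of_ne ha with hlt | hgt
        · refine Or.inl ⟨hzD', ?_⟩
          rw [abs_of_pos (sub_pos.2 hlt)] at hεδ
          have := (abs_le.1 hnorm).1
          linarith
        · refine Or.inr (Or.inr ?_)
          rw [abs_of_neg (sub_neg.2 hgt)] at hεδ
          have := (abs_le.1 hnorm).2
          linarith
  · -- the shape of the members
    rintro _ ⟨⟨z, p, q⟩, ⟨hz, hp0, hpq, hadm⟩, rfl⟩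
    obtain ⟨hρI, hρbad⟩ := hρ z p q hpq
    refine ⟨z, ρ z p q, ?_, hρbad, rfl, ?_⟩
    · have : (0 : ℝ) < p := by exact_mod_cast hp0
      exact this.trans hρI.1
    · rcases hadm with ⟨hzD', hq⟩ | h1 | hq
      · exact Or.inl ⟨hD'D hzD', hρI.2.le.trans hq⟩
      · exact Or.inr (Or.inl h1)
      · exact Or.inr (Or.inr (hρI.2.le.trans hq))

/-! ### The avoidance events of `Q_δ` are complements of connection events -/

/-- **LSW's avoidance event is the complement of a connection event.** For `R > 0` and an open
set `U ⊆ 𝕌`, `Q_{1/R} ∩ U = ∅` iff there is no open path of `𝕋` from a site `x` with `x/R ∈ U`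
to a site `y` with `‖y‖ > R` (LSW 2002, §2, p. 3: `Q_δ` is the union of `∂𝕌` and the clusters of
the disc meeting `∂𝕌`). [cite: LawlerSchrammWernerEJP2002, §2 (p. 3)] -/
theorem lswCompact_mem_setOf_disjoint_iff {R : ℝ} (hR : 0 < R) {U : Set ℂ}
    (hU : U ⊆ ball (0 : ℂ) 1) (ω : SiteConfig (Site 2)) :
    lswCompact R ω ∈ {K : NonemptyCompacts ℂ | Disjoint (K : Set ℂ) U} ↔
      ¬ ∃ x y : Site 2, triMeshPoint R⁻¹ x ∈ U ∧ R < ‖triEmbed y‖ ∧ PathIn triGraph ω x y := by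
  rw [mem_setOf_eq, coe_lswCompact, lswSet, disjoint_union_left]
  constructor
  · rintro ⟨-, h⟩ ⟨x, y, hxU, hy, hp⟩
    have hxR : ‖triEmbed x‖ < R := by
      have h1 : ‖triMeshPoint R⁻¹ x‖ < 1 := by simpa using hU hxU
      rwa [norm_triMeshPoint_inv hR, div_lt_one hR] at h1
    exact disjoint_left.1 h (mem_image_of_mem _ ⟨hxR, y, hy, hp⟩) hxU
  · intro h
    constructor
    · refine disjoint_left.2 fun w hw hwU => ?_
      have h1 : ‖w‖ < 1 := by simpa using hU hwU
      have h2 : ‖w‖ = 1 := by simpa using hw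
      exact (lt_irrefl (1 : ℝ)) (h2 ▸ h1)
    · refine disjoint_left.2 ?_
      rintro _ ⟨x, ⟨-, y, hy, hp⟩, rfl⟩ hxU
      exact h ⟨x, y, hxU, hy, hp⟩

/-- A disc meeting the unit circle is never avoided by `Q_δ ⊇ ∂𝕌`. [folklore] -/
theorem lswCompact_not_mem_setOf_disjoint_of_mem_sphere {R : ℝ} {U : Set ℂ} {z : ℂ}
    (hz : z ∈ U) (hz1 : ‖z‖ = 1) (ω : SiteConfig (Site 2)) :
    lswCompact R ω ∉ {K : NonemptyCompacts ℂ | Disjoint (K : Set ℂ) U} := by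
  intro h
  rw [mem_setOf_eq, coe_lswCompact] at h
  exact disjoint_left.1 h (Or.inl (by simpa using hz1)) hz

/-- Sets missing the closed unit disc do not affect the avoidance events of `Q_δ ⊆ Ū`. [folklore] -/
theorem lswCompact_mem_setOf_disjoint_union_iff {R : ℝ} {U W : Set ℂ}
    (hW : Disjoint W (closedBall (0 : ℂ) 1)) (ω : SiteConfig (Site 2)) :
    lswCompact R ω ∈ {K : NonemptyCompacts ℂ | Disjoint (K : Set ℂ) (U ∪ W)} ↔
      lswCompact R ω ∈ {K : NonemptyCompacts ℂ | Disjoint (K : Set ℂ) U} := by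
  simp only [mem_setOf_eq, disjoint_union_right, and_iff_left_iff_imp]
  intro _
  rw [coe_lswCompact]
  exact Disjoint.symm (hW.mono_right (lswSet_subset_closedBall R ω))

/-- **The avoidance probability is one minus the connection probability**: for `R > 0` and an
open `U ⊆ 𝕌`, `P[Q_{1/R} ∩ U = ∅] = 1 - P_{1/2}[∃ x y, x/R ∈ U, ‖y‖ > R, x ↔ y]`.
[cite: LawlerSchrammWernerEJP2002, §2 (p. 3)] -/
theorem lswLaw_setOf_disjoint_eq {R : ℝ} (hR : 0 < R) {U : Set ℂ} (hUo : IsOpen U)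
    (hU : U ⊆ ball (0 : ℂ) 1) :
    ((lswLaw R {K : NonemptyCompacts ℂ | Disjoint (K : Set ℂ) U} : ℝ≥0) : ℝ) =
      1 - (triSitePercolation half).real
        {ω | ∃ x y : Site 2, triMeshPoint R⁻¹ x ∈ U ∧ R < ‖triEmbed y‖ ∧ PathIn triGraph ω x y} := by
  have hmeas : MeasurableSet {K : NonemptyCompacts ℂ | Disjoint (K : Set ℂ) U} :=
    measurableSet_setOf_disjoint hUo
  have hpre : lswCompact R ⁻¹' {K : NonemptyCompacts ℂ | Disjoint (K : Set ℂ) U} =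
      {ω | ∃ x y : Site 2, triMeshPoint R⁻¹ x ∈ U ∧ R < ‖triEmbed y‖ ∧ PathIn triGraph ω x y}ᶜ := by
    ext ω
    exact lswCompact_mem_setOf_disjoint_iff hR hU ω
  have hEmeas : MeasurableSet
      {ω | ∃ x y : Site 2, triMeshPoint R⁻¹ x ∈ U ∧ R < ‖triEmbed y‖ ∧ PathIn triGraph ω x y} := by
    have := (measurable_lswCompact R hmeas)
    rw [hpre] at this
    exact MeasurableSet.of_compl this
  have h1 : ((lswLaw R {K : NonemptyCompacts ℂ | Disjoint (K : Set ℂ) U} : ℝ≥0) : ℝ) =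
      ((lswLaw R : Measure (NonemptyCompacts ℂ)) {K | Disjoint (K : Set ℂ) U}).toReal := by
    rw [← ProbabilityMeasure.ennreal_coeFn_eq_coeFn_toMeasure, ENNReal.coe_toReal]
  rw [h1, lswLaw_apply R hmeas, hpre, ← measureReal_def, measureReal_compl hEmeas,
    coe_triSiteLawHalf.symm]
  simp

end Literature.Probability.Percolation
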